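import Summits.QuantumFields.BalabanUV.Beta.EriceFlowEnclosureB12AsPrintedHistoryContagionShiftFlowZero

/-!
# Beta / EriceFlowEnclosureB12AsPrintedHistoryContagionShiftFlowZeroClock — ASYMPTOTIC FREEDOM IS CONTAGIOUS, part 33: THE ONE-LOOP LAW AND THE UNIVERSAL CLOCK OF EVERY
# ASYMPTOTICALLY FREE TRAJECTORY OF A FLOW WITH MEMORY.  Part 32 gave a fading-memory functional `B` ONE value β₀ at the zero history (`|B(u) − β₀| ≤ C_m·Σ_j θ^j u_j`)
# and showed `β* ≤ β₀` from ONE asymptotically free box solution.  Here (§52): EVERY asymptotically free box solution t of `MemFlow B g* t` — any box, any constants, NO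
# smallness — obeys THE ONE-LOOP LAW **`|1∕t(m)² − 1∕g*² − m·β₀| ≤ (2C_m∕((1 − θ)β*))·√(1∕t_a² + β*m)`** (`abs_invSq_sub_oneLoop_le`): the chart 1∕t² is climbed at
# the asymptotic speed β₀ with a SQUARE-ROOT defect (each memory term reads a tail below `(1∕t_a² + β*(l+1))^{−1∕2}`, and these sum to the root), whence THE UNIVERSAL
# ONE-LOOP CLOCK **`m·t(m)² → 1∕β₀`** (`tendsto_mul_sq`; `(1∕t(m)²)∕m → β₀`, `tendsto_invSq_div`) — ONE number β₀ = B(0⁺) for every trajectory, every pin, every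
# reference — and THE RIGID TRANSLATION IN THE ULTRAVIOLET: **`1∕t(n+k)² − 1∕t(n)² → k·β₀`** (`tendsto_invSq_shift_sub`).  §53 reads it near zero pin through part 10's
# contagion (every box solution from a small pin e carries the profile `(2e, β*∕4)`: defect `(8C_m∕((1 − θ)β*))·√(1∕(2e)² + β*m∕4)`, clock `m·h(m)² → 1∕β₀`), and §54 for
# part 31's effective beta function: **`|β_eff(g) − β₀| ≤ 2C_m g∕(1 − θ)`** (`abs_effBeta_sub_valueAtZero_le`) — the one-step renormalization map `R g = solution B g 1`
# is, in the chart 1∕g², THE TRANSLATION BY β₀ up to O(g): `1∕R(g)² = 1∕g² + β₀ + O(g)`; β_eff extends continuously to g = 0 with the value β₀.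
# Abstract in B (β-flow team, prover 1, unit `b2b-balaban-beta-bflow-p1`, gen 39; ROW AP-I·Uc × NODE U2 — the one-loop law near the zero history)

HONEST FRAMING (page 1 of everything the β sub-cell writes): discharging `BetaPertH` makes Bałaban's UV stability UNCONDITIONAL — a
real constructive-QFT result; it is NOT the continuum limit and NOT the Clay problem.  HONEST DEPENDENCY (cell reorg 2026-08-19,
verbatim): «continuum YM on T⁴ ⇐ BetaPertH ∧ nine spine estimates (0/9 proved); BetaPertH ⇐ (D1) ∧ (D4) ∧ CAP+tail; G-an2-4 gates
asym, D1 and NE2/3/4.»  THIS MODULE DISCHARGES NOTHING: elementary real analysis (a telescoping sum against a square-root profile, `√a_m∕m → 0`, an ε∕n₀ argument) over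
node U2's HYPOTHESIS SHAPES `T4BetaStationary.{SeqBox, MemoryProfile}`, `T4BetaFlowWellPosed.{MemFlow, solution}` on an ABSTRACT functional `B`; part 32's
`abs_sub_valueAtZero_le ∕ tail_le_invSprof ∕ valueAtZero_pos`, part 10's `invSq_lower_of_reference_flow ∕ le_two_mul_pin_of_reference_flow`, part 13's
`memFlow_solution_of_reference`, part 25's `exists_tail_scale_le`, `…HistoryUniformDepth.sum_invSprof_le` and node U2's `T4CouplingMatching.sprof` BY NAME — nothing restated.
PRECEDENT (by name, not imported): d4-p2's (E52e) `EriceRemainderEnclosureHistoryAutonomyFunctionalShiftMemoryless.abs_invSq_sub_oneLoop_le_sum` — the one-loop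
telescoping GIVEN a floor on the whole box and GIVEN the constant b₀ as data; here both are DERIVED (part 32) and the box is arbitrary against the profile; their (E54d)
`…TwoLoopCoefficients.tendsto_inv_mul_sq` reads the clock off a TWO-loop Λ.  `ScaleShiftRate` (GAPS G-t4-U2-1), `HistLipschitz`∕`FadingMemory` (G-t4-U2-2), [I] THEOREM 2
(p. 259, STATED WITHOUT PROOF) do not occur in this abstract part (carrier END: part 36); NOTHING is asserted about Bałaban's actual β — that ITS running coupling obeys
`m·g_m² → 1∕β₀` with the printed `β₀` is Erice's (3.75)–(3.76) (p. 250) ∕ [I] (0.19), NOT PROVED for the functional with memory ([I] p. 298).  [I] = T. Bałaban, Commun.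
Math. Phys. **109** (1987) 249–301 [Balaban1987RG1].

WHAT THIS FILE PROVES (0 sorry, 0 def): §52 `abs_invSq_sub_oneLoop_le_sum`, `sum_invSprof_succ_le`, **`abs_invSq_sub_oneLoop_le`**, `tendsto_sprof_div`, **`tendsto_invSq_div`**,
**`tendsto_mul_sq`**, **`tendsto_invSq_shift_sub`**; §53 `abs_invSq_sub_oneLoop_le_of_reference_flow`, `tendsto_mul_sq_of_reference_flow`; §54 **`abs_effBeta_sub_valueAtZero_le`**.
NOT CLAIMED: a two-loop law or an ABSOLUTE Λ-parameter `lim (1∕t(m)² − m·β₀)` — false at this generality: the square-root defect is attained (part 37); anything about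
Bałaban's β; `BetaPertH`; continuum; Clay.
-/

namespace Summit.QuantumFields.BalabanUV.Beta.EriceFlowEnclosureB12AsPrintedHistoryContagionShiftFlowZeroClock

open Finset Filter Topology
open Literature.MathematicalPhysics.QuantumFieldTheory.Balaban1983to89
open Literature.MathematicalPhysics.QuantumFieldTheory.Balaban1983to89.T4CouplingMatching (prof sprof sprof_pos sprof_sq prof_pos sprof_zero)
open Literature.MathematicalPhysics.QuantumFieldTheory.Balaban1983to89.T4BetaStationary (SeqBox MemoryProfile)
open Literature.MathematicalPhysics.QuantumFieldTheory.Balaban1983to89.T4BetaFlowWellPosed (MemFlow solution seqBox_shift)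
open Summit.QuantumFields.BalabanUV.Beta.EriceFlowEnclosureB12AsPrintedHistoryUniformDepth (sum_invSprof_le)
open Summit.QuantumFields.BalabanUV.Beta.EriceFlowEnclosureB12AsPrintedHistoryContagionShiftFlow (invSq_lower_of_reference_flow le_two_mul_pin_of_reference_flow)
open Summit.QuantumFields.BalabanUV.Beta.EriceFlowEnclosureB12AsPrintedHistoryContagionShiftFlowPicardLimit (memFlow_solution_of_reference)
open Summit.QuantumFields.BalabanUV.Beta.EriceFlowEnclosureB12AsPrintedHistoryContagionShiftFlowRepinTail (one_div_sprof_pos exists_tail_scale_le)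
open Summit.QuantumFields.BalabanUV.Beta.EriceFlowEnclosureB12AsPrintedHistoryContagionShiftFlowZero (abs_sub_valueAtZero_le tail_le_invSprof valueAtZero_pos)

noncomputable section

/-! ## §52 The one-loop law of every asymptotically free trajectory, and the universal clock -/

/-- **ONE-LOOP TELESCOPING AGAINST AN ENVELOPE OF THE TAILS.**  `B` with the value β₀ at the zero history; a box solution t of `MemFlow B g* t` whose tail beyond every
scale q lies below `E q` (`t(q + j) ≤ E q`).  THEN `|1∕t(m)² − 1∕g*² − m·β₀| ≤ (C_m∕(1 − θ))·Σ_{l<m} E(l+1)` — each memory term is β₀ up to the modulus of its tail.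
[folklore] -/
theorem abs_invSq_sub_oneLoop_le_sum {B : (ℕ → ℝ) → ℝ} {Cm θ γ β₀ gs : ℝ} {t E : ℕ → ℝ} (hCm : 0 ≤ Cm) (hθ0 : 0 ≤ θ) (hθ1 : θ < 1)
    (h0 : ∀ u : ℕ → ℝ, SeqBox γ u → |B u - β₀| ≤ Cm * ∑' j, θ ^ j * u j)
    (hts : SeqBox γ t) (htf : MemFlow B gs t) (hE : ∀ q j, t (q + j) ≤ E q) (m : ℕ) :
    |1 / t m ^ 2 - 1 / gs ^ 2 - (m : ℝ) * β₀| ≤ Cm / (1 - θ) * ∑ l ∈ range m, E (l + 1) := by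
  induction m with
  | zero => simp [htf.1]
  | succ m ih =>
    have hstep := abs_sub_valueAtZero_le hCm hθ0 hθ1 h0 (seqBox_shift hts (m + 1)) (fun j => hE (m + 1) j)
    have e : 1 / t (m + 1) ^ 2 - 1 / gs ^ 2 - ((m + 1 : ℕ) : ℝ) * β₀
        = (1 / t m ^ 2 - 1 / gs ^ 2 - (m : ℝ) * β₀) + (B (fun j => t (m + 1 + j)) - β₀) := by
      rw [htf.2 m]; push_cast; ring
    rw [e, sum_range_succ, mul_add]
    refine (abs_add_le _ _).trans (add_le_add ih ?_)
    calc |B (fun j => t (m + 1 + j)) - β₀| ≤ Cm * E (m + 1) / (1 - θ) := hstep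
      _ = Cm / (1 - θ) * E (m + 1) := by ring

/-- The shifted profile sum: `Σ_{l<m} 1∕√(1∕t_a² + β*(l+1)) ≤ (2∕β*)·√(1∕t_a² + β*m)` (`sum_invSprof_le` minus its first term). [folklore] -/
theorem sum_invSprof_succ_le {ta bs : ℝ} (hta : 0 < ta) (hbs : 0 < bs) (m : ℕ) :
    ∑ l ∈ range m, 1 / sprof ta bs (l + 1) ≤ 2 / bs * sprof ta bs m := by
  have h := sum_invSprof_le hta hbs m
  rw [sum_range_succ', sprof_zero hta, one_div_one_div] at h
  linarith

/-- **THE ONE-LOOP LAW OF EVERY ASYMPTOTICALLY FREE TRAJECTORY — NO SMALLNESS.**  `B` with the value β₀ at the zero history (modulus `C_m·Σ θ^j u_j`, C_m ≥ 0,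
0 ≤ θ < 1) on a box of ANY size; ANY box solution t of `MemFlow B g* t` with an AF profile `1∕t_a² + β*·m ≤ 1∕t(m)²` (β* > 0, t_a > 0).  THEN for every m:
**`|1∕t(m)² − 1∕g*² − m·β₀| ≤ (2C_m∕((1 − θ)β*))·√(1∕t_a² + β*·m)`** — the chart 1∕t² is climbed at the asymptotic speed β₀ = B(0⁺) with a SQUARE-ROOT defect (the
tail beyond scale l+1 lies below `(1∕t_a² + β*(l+1))^{−1∕2}`, and these sum to the displayed root). [cite: Balaban1987RG1, Thm 2 (0.31) p.259 with (0.20) p.256 and p.298] -/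
theorem abs_invSq_sub_oneLoop_le {B : (ℕ → ℝ) → ℝ} {Cm θ γ β₀ bs ta gs : ℝ} {t : ℕ → ℝ} (hCm : 0 ≤ Cm) (hθ0 : 0 ≤ θ) (hθ1 : θ < 1) (hbs : 0 < bs) (hta : 0 < ta)
    (h0 : ∀ u : ℕ → ℝ, SeqBox γ u → |B u - β₀| ≤ Cm * ∑' j, θ ^ j * u j)
    (hts : SeqBox γ t) (htf : MemFlow B gs t) (hprof : ∀ m : ℕ, 1 / ta ^ 2 + bs * (m : ℝ) ≤ 1 / (t m) ^ 2) (m : ℕ) :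
    |1 / t m ^ 2 - 1 / gs ^ 2 - (m : ℝ) * β₀| ≤ 2 * Cm / ((1 - θ) * bs) * sprof ta bs m := by
  have h1θ : 0 < 1 - θ := by linarith
  have h := abs_invSq_sub_oneLoop_le_sum hCm hθ0 hθ1 h0 hts htf
    (fun q j => tail_le_invSprof hta hbs.le (fun q => (hts q).1) hprof q j) m
  have hs := sum_invSprof_succ_le hta hbs m
  calc |1 / t m ^ 2 - 1 / gs ^ 2 - (m : ℝ) * β₀| ≤ Cm / (1 - θ) * ∑ l ∈ range m, 1 / sprof ta bs (l + 1) := h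
    _ ≤ Cm / (1 - θ) * (2 / bs * sprof ta bs m) := mul_le_mul_of_nonneg_left hs (by positivity)
    _ = 2 * Cm / ((1 - θ) * bs) * sprof ta bs m := by field_simp

/-- The square-root profile is negligible against the scale: `√(1∕t_a² + β*m)∕m → 0`. [folklore] -/
theorem tendsto_sprof_div {ta bs : ℝ} (hta : 0 < ta) (hbs : 0 ≤ bs) : Tendsto (fun m : ℕ => sprof ta bs m / (m : ℝ)) atTop (𝓝 0) := by
  -- squares: `(√a_m ∕ m)² = (1∕t_a²)∕m² + β*∕m → 0`
  have hsq : Tendsto (fun m : ℕ => (sprof ta bs m / (m : ℝ)) ^ 2) atTop (𝓝 0) := by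
    have h1 : Tendsto (fun m : ℕ => (1 / ta ^ 2) * ((m : ℝ) ^ 2)⁻¹ + bs * ((m : ℝ))⁻¹) atTop (𝓝 ((1 / ta ^ 2) * 0 + bs * 0)) := by
      refine ((tendsto_inv_atTop_zero.comp ?_).const_mul _).add ((tendsto_inv_atTop_zero.comp tendsto_natCast_atTop_atTop).const_mul _)
      exact (tendsto_pow_atTop two_ne_zero).comp tendsto_natCast_atTop_atTop
    rw [mul_zero, mul_zero, add_zero] at h1
    refine (h1.congr' ?_)
    filter_upwards [eventually_gt_atTop 0] with m hm
    have hm' : (0 : ℝ) < m := by exact_mod_cast hm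
    rw [div_pow, sprof_sq hta hbs]
    unfold T4CouplingMatching.prof
    field_simp
  have hnn : ∀ m : ℕ, 0 ≤ sprof ta bs m / (m : ℝ) := fun m => div_nonneg (sprof_pos hta hbs m).le (Nat.cast_nonneg m)
  have := hsq.sqrt
  rw [Real.sqrt_zero] at this
  exact this.congr fun m => by rw [Real.sqrt_sq (hnn m)]

/-- **THE ASYMPTOTIC SPEED IN THE CHART IS β₀**: under the data of `abs_invSq_sub_oneLoop_le`, `(1∕t(m)²)∕m → β₀`. [cite: Balaban1987RG1, Thm 2 (0.31) p.259 with (0.20) p.256] -/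
theorem tendsto_invSq_div {B : (ℕ → ℝ) → ℝ} {Cm θ γ β₀ bs ta gs : ℝ} {t : ℕ → ℝ} (hCm : 0 ≤ Cm) (hθ0 : 0 ≤ θ) (hθ1 : θ < 1) (hbs : 0 < bs) (hta : 0 < ta)
    (h0 : ∀ u : ℕ → ℝ, SeqBox γ u → |B u - β₀| ≤ Cm * ∑' j, θ ^ j * u j)
    (hts : SeqBox γ t) (htf : MemFlow B gs t) (hprof : ∀ m : ℕ, 1 / ta ^ 2 + bs * (m : ℝ) ≤ 1 / (t m) ^ 2) :
    Tendsto (fun m : ℕ => (1 / t m ^ 2) / (m : ℝ)) atTop (𝓝 β₀) := by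
  have h1θ : 0 < 1 - θ := by linarith
  set K : ℝ := 2 * Cm / ((1 - θ) * bs) with hK
  have hK0 : 0 ≤ K := by positivity
  -- the error: `|(1∕t(m)²)∕m − β₀| ≤ (1∕g*²)∕m + K·√a_m∕m`
  have herr : Tendsto (fun m : ℕ => (1 / gs ^ 2) * ((m : ℝ))⁻¹ + K * (sprof ta bs m / (m : ℝ))) atTop (𝓝 ((1 / gs ^ 2) * 0 + K * 0)) :=
    ((tendsto_inv_atTop_zero.comp tendsto_natCast_atTop_atTop).const_mul _).add ((tendsto_sprof_div hta hbs.le).const_mul K)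
  rw [mul_zero, mul_zero, add_zero] at herr
  refine tendsto_iff_norm_sub_tendsto_zero.mpr (squeeze_zero' (Eventually.of_forall fun m => norm_nonneg _) ?_ herr)
  filter_upwards [eventually_gt_atTop 0] with m hm
  have hm' : (0 : ℝ) < m := by exact_mod_cast hm
  rw [Real.norm_eq_abs]
  have h := abs_invSq_sub_oneLoop_le hCm hθ0 hθ1 hbs hta h0 hts htf hprof m
  have e : (1 / t m ^ 2) / (m : ℝ) - β₀ = (1 / t m ^ 2 - 1 / gs ^ 2 - (m : ℝ) * β₀) / m + (1 / gs ^ 2) / m := by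
    field_simp; ring
  have h1 : |(1 / t m ^ 2 - 1 / gs ^ 2 - (m : ℝ) * β₀) / (m : ℝ)| ≤ K * (sprof ta bs m / (m : ℝ)) := by
    rw [abs_div, abs_of_pos hm', div_le_iff₀ hm', show K * (sprof ta bs m / (m : ℝ)) * m = K * sprof ta bs m by field_simp, hK]
    exact h
  have h2 : |(1 : ℝ) / gs ^ 2 / (m : ℝ)| = 1 / gs ^ 2 * ((m : ℝ))⁻¹ := by
    rw [abs_of_nonneg (by positivity)]; ring
  rw [e]
  exact (abs_add_le _ _).trans (by linarith)

/-- **THE UNIVERSAL ONE-LOOP CLOCK: `m·t(m)² → 1∕β₀`.**  `B` with the value β₀ at the zero history on a box of ANY size; ANY asymptotically free box solution t of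
`MemFlow B g* t` (profile of any rate β* > 0, any scale; NO smallness).  THEN **`m·t(m)² → 1∕β₀`** — the running coupling squared decays like `1∕(β₀ m)` with β₀ THE
value of the functional at the zero history: the same for every trajectory, every pin and every reference (β* ≤ β₀ always, `rate_le_valueAtZero`).
[cite: Balaban1987RG1, Thm 2 (0.31) p.259 with (0.20) p.256 and p.298] -/
theorem tendsto_mul_sq {B : (ℕ → ℝ) → ℝ} {Cm θ γ β₀ bs ta gs : ℝ} {t : ℕ → ℝ} (hCm : 0 ≤ Cm) (hθ0 : 0 ≤ θ) (hθ1 : θ < 1) (hbs : 0 < bs) (hta : 0 < ta)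
    (h0 : ∀ u : ℕ → ℝ, SeqBox γ u → |B u - β₀| ≤ Cm * ∑' j, θ ^ j * u j)
    (hts : SeqBox γ t) (htf : MemFlow B gs t) (hprof : ∀ m : ℕ, 1 / ta ^ 2 + bs * (m : ℝ) ≤ 1 / (t m) ^ 2) :
    Tendsto (fun m : ℕ => (m : ℝ) * t m ^ 2) atTop (𝓝 (1 / β₀)) := by
  have hβ₀ := valueAtZero_pos hCm hθ0 hθ1 hbs hta h0 hts htf hprof
  have h := (tendsto_invSq_div hCm hθ0 hθ1 hbs hta h0 hts htf hprof).inv₀ hβ₀.ne'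
  rw [← one_div] at h
  refine h.congr' ?_
  filter_upwards [eventually_gt_atTop 0] with m hm
  have hm' : (0 : ℝ) < m := by exact_mod_cast hm
  have htm := (hts m).1
  field_simp

/-- **THE CHART INCREMENTS OVER k SCALES CONVERGE TO k·β₀.**  Under the data of `abs_invSq_sub_oneLoop_le` (ANY AF box solution, NO smallness), for every k:
**`1∕t(n+k)² − 1∕t(n)² → k·β₀`** as n → ∞ — deep in the ultraviolet the renormalization group of the flow with memory acts on the chart by the RIGID TRANSLATION by β₀ per
scale (each of the k memory terms reads a tail below `(1∕t_a² + β*n)^{−1∕2} → 0`). [cite: Balaban1987RG1, Thm 2 (0.31) p.259 with (0.20) p.256 and p.298] -/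
theorem tendsto_invSq_shift_sub {B : (ℕ → ℝ) → ℝ} {Cm θ γ β₀ bs ta gs : ℝ} {t : ℕ → ℝ} (hCm : 0 ≤ Cm) (hθ0 : 0 ≤ θ) (hθ1 : θ < 1) (hbs : 0 < bs) (hta : 0 < ta)
    (h0 : ∀ u : ℕ → ℝ, SeqBox γ u → |B u - β₀| ≤ Cm * ∑' j, θ ^ j * u j)
    (hts : SeqBox γ t) (htf : MemFlow B gs t) (hprof : ∀ m : ℕ, 1 / ta ^ 2 + bs * (m : ℝ) ≤ 1 / (t m) ^ 2) (k : ℕ) :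
    Tendsto (fun n : ℕ => 1 / t (n + k) ^ 2 - 1 / t n ^ 2) atTop (𝓝 ((k : ℝ) * β₀)) := by
  have h1θ : 0 < 1 - θ := by linarith
  -- at every n: `|1∕t(n+k)² − 1∕t(n)² − kβ₀| ≤ k · C_m∕(1−θ) · 1∕√a_n`
  have hbound : ∀ n : ℕ, |1 / t (n + k) ^ 2 - 1 / t n ^ 2 - (k : ℝ) * β₀| ≤ (k : ℝ) * (Cm / (1 - θ) * (1 / sprof ta bs n)) := by
    intro n
    induction k with
    | zero => simp
    | succ k ih =>
      have hstep := abs_sub_valueAtZero_le (a := 1 / sprof ta bs n) hCm hθ0 hθ1 h0 (seqBox_shift hts (n + k + 1))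
        (fun j => by
          have := tail_le_invSprof hta hbs.le (fun q => (hts q).1) hprof n (k + 1 + j)
          rwa [show n + (k + 1 + j) = n + k + 1 + j by omega] at this)
      have e : 1 / t (n + (k + 1)) ^ 2 - 1 / t n ^ 2 - ((k + 1 : ℕ) : ℝ) * β₀
          = (1 / t (n + k) ^ 2 - 1 / t n ^ 2 - (k : ℝ) * β₀) + (B (fun j => t (n + k + 1 + j)) - β₀) := by
        rw [show n + (k + 1) = n + k + 1 by omega, htf.2 (n + k)]; push_cast; ring
      rw [e]
      refine (abs_add_le _ _).trans ?_
      push_cast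
      have : Cm * (1 / sprof ta bs n) / (1 - θ) = Cm / (1 - θ) * (1 / sprof ta bs n) := by ring
      linarith [ih, hstep]
  -- and `1∕√a_n → 0`
  have hlim : Tendsto (fun n : ℕ => (k : ℝ) * (Cm / (1 - θ) * (1 / sprof ta bs n))) atTop (𝓝 ((k : ℝ) * (Cm / (1 - θ) * 0))) := by
    refine ((Metric.tendsto_atTop.mpr fun ε hε => ?_).const_mul _).const_mul _
    obtain ⟨n₀, hn₀⟩ := exists_tail_scale_le hta hbs (half_pos hε)
    refine ⟨n₀, fun n hn => ?_⟩
    rw [Real.dist_eq, sub_zero, abs_of_pos (one_div_sprof_pos hta hbs.le n)]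
    linarith [hn₀ n hn]
  rw [mul_zero, mul_zero] at hlim
  refine tendsto_iff_norm_sub_tendsto_zero.mpr (squeeze_zero' (Eventually.of_forall fun n => norm_nonneg _) (Eventually.of_forall fun n => ?_) hlim)
  rw [Real.norm_eq_abs]
  exact hbound n

/-! ## §53 Near zero pin: every box solution from a small pin -/

/-- **THE ONE-LOOP LAW NEAR ZERO PIN.**  `B` with memory profile `(C_m, θ)` on ]0, γ]^ℕ and the value β₀ at the zero history; ONE AF reference t (`MemFlow B g* t`,
profile `1∕t_a² + β*·m ≤ 1∕t(m)²`); a pin e with part 10's smallness `4C_m e ≤ β*(1 − θ)`, `e²·(1∕g*² + C_mγ∕(1 − θ)² + (2C_m∕((1 − θ)β*))²) ≤ 3∕4`; ANY box solution h of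
`MemFlow B e h`.  THEN for every m: **`|1∕h(m)² − 1∕e² − m·β₀| ≤ (8C_m∕((1 − θ)β*))·√(1∕(2e)² + (β*∕4)m)`** (part 10's contagion gives h the profile `(2e, β*∕4)`; §52).
[cite: Balaban1987RG1, Thm 2 (0.31) p.259 with (0.20) p.256 and p.298] -/
theorem abs_invSq_sub_oneLoop_le_of_reference_flow {B : (ℕ → ℝ) → ℝ} {Cm θ γ β₀ bs ta gs e : ℝ} {t h : ℕ → ℝ}
    (hB : MemoryProfile Cm θ γ B) (hCm : 0 ≤ Cm) (hθ0 : 0 ≤ θ) (hθ1 : θ < 1) (hbs : 0 < bs) (hta : 0 < ta)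
    (h0 : ∀ u : ℕ → ℝ, SeqBox γ u → |B u - β₀| ≤ Cm * ∑' j, θ ^ j * u j)
    (hts : SeqBox γ t) (htf : MemFlow B gs t) (hprof : ∀ m : ℕ, 1 / ta ^ 2 + bs * (m : ℝ) ≤ 1 / (t m) ^ 2)
    (hhs : SeqBox γ h) (hhf : MemFlow B e h)
    (hs1 : 4 * Cm * e ≤ bs * (1 - θ))
    (hs2 : e ^ 2 * (1 / gs ^ 2 + Cm * γ / (1 - θ) ^ 2 + (2 * Cm / ((1 - θ) * bs)) ^ 2) ≤ 3 / 4) (m : ℕ) :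
    |1 / h m ^ 2 - 1 / e ^ 2 - (m : ℝ) * β₀| ≤ 8 * Cm / ((1 - θ) * bs) * sprof (2 * e) (bs / 4) m := by
  have he : 0 < e := by rw [← hhf.1]; exact (hhs 0).1
  have hprofh : ∀ m : ℕ, 1 / (2 * e) ^ 2 + bs / 4 * (m : ℝ) ≤ 1 / (h m) ^ 2 := fun m => by
    have := invSq_lower_of_reference_flow hB hCm hθ0 hθ1 hbs hta hts htf hprof hhs hhf hs1 hs2 m
    rwa [show (1 : ℝ) / (2 * e) ^ 2 = 1 / (4 * e ^ 2) by ring]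
  have h := abs_invSq_sub_oneLoop_le hCm hθ0 hθ1 (by positivity : 0 < bs / 4) (by positivity : 0 < 2 * e) h0 hhs hhf hprofh m
  rwa [show 2 * Cm / ((1 - θ) * (bs / 4)) = 8 * Cm / ((1 - θ) * bs) by field_simp; ring] at h

/-- **THE ONE-LOOP CLOCK NEAR ZERO PIN**: under the data of `abs_invSq_sub_oneLoop_le_of_reference_flow`, `m·h(m)² → 1∕β₀` for EVERY box solution h from EVERY small
pin e — one number β₀ for all of them. [cite: Balaban1987RG1, Thm 2 (0.31) p.259 with (0.20) p.256 and p.298] -/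
theorem tendsto_mul_sq_of_reference_flow {B : (ℕ → ℝ) → ℝ} {Cm θ γ β₀ bs ta gs e : ℝ} {t h : ℕ → ℝ}
    (hB : MemoryProfile Cm θ γ B) (hCm : 0 ≤ Cm) (hθ0 : 0 ≤ θ) (hθ1 : θ < 1) (hbs : 0 < bs) (hta : 0 < ta)
    (h0 : ∀ u : ℕ → ℝ, SeqBox γ u → |B u - β₀| ≤ Cm * ∑' j, θ ^ j * u j)
    (hts : SeqBox γ t) (htf : MemFlow B gs t) (hprof : ∀ m : ℕ, 1 / ta ^ 2 + bs * (m : ℝ) ≤ 1 / (t m) ^ 2)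
    (hhs : SeqBox γ h) (hhf : MemFlow B e h)
    (hs1 : 4 * Cm * e ≤ bs * (1 - θ))
    (hs2 : e ^ 2 * (1 / gs ^ 2 + Cm * γ / (1 - θ) ^ 2 + (2 * Cm / ((1 - θ) * bs)) ^ 2) ≤ 3 / 4) :
    Tendsto (fun m : ℕ => (m : ℝ) * h m ^ 2) atTop (𝓝 (1 / β₀)) := by
  have he : 0 < e := by rw [← hhf.1]; exact (hhs 0).1
  have hprofh : ∀ m : ℕ, 1 / (2 * e) ^ 2 + bs / 4 * (m : ℝ) ≤ 1 / (h m) ^ 2 := fun m => by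
    have := invSq_lower_of_reference_flow hB hCm hθ0 hθ1 hbs hta hts htf hprof hhs hhf hs1 hs2 m
    rwa [show (1 : ℝ) / (2 * e) ^ 2 = 1 / (4 * e ^ 2) by ring]
  exact tendsto_mul_sq hCm hθ0 hθ1 (by positivity : 0 < bs / 4) (by positivity : 0 < 2 * e) h0 hhs hhf hprofh

/-! ## §54 The effective beta function tends to the value at the zero history -/

/-- **`|β_eff(g) − β₀| ≤ 2C_m g∕(1 − θ)`: THE ONE-STEP RENORMALIZATION MAP IS THE CHART TRANSLATION BY β₀ UP TO O(g).**  `B` with memory profile `(C_m, θ)` on ]0, γ]^ℕ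
and the value β₀ at the zero history; ONE AF reference t; a pin g with part 13's smallness (`2g ≤ γ`, `4C_m g ≤ β*(1 − θ)`, `g²·Q ≤ 3∕4`, `64C_m g³ ≤ (1 − θ)²`).  THEN
part 31's effective beta function `β_eff(g) = 1∕(solution B g 1)² − 1∕g²` satisfies **`|β_eff(g) − β₀| ≤ 2C_m g∕(1 − θ)`**: it is the value of B on the tail of node
U2's solution from g, which lies below 2g (part 10).  So `1∕R(g)² = 1∕g² + β₀ + O(g)` for the one-step map `R g = solution B g 1`: β_eff extends continuously to g = 0 with
the value β₀, and β₀ is ALSO the g → 0⁺ limit of part 31's Markov recursion. [cite: Balaban1987RG1, Thm 2 (0.31) p.259 with (0.20) p.256 and p.298] -/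
theorem abs_effBeta_sub_valueAtZero_le {B : (ℕ → ℝ) → ℝ} {Cm θ γ β₀ bs ta gs g : ℝ} {t : ℕ → ℝ}
    (hB : MemoryProfile Cm θ γ B) (hCm : 0 ≤ Cm) (hθ0 : 0 ≤ θ) (hθ1 : θ < 1) (hbs : 0 < bs) (hta : 0 < ta)
    (h0 : ∀ u : ℕ → ℝ, SeqBox γ u → |B u - β₀| ≤ Cm * ∑' j, θ ^ j * u j)
    (hts : SeqBox γ t) (htf : MemFlow B gs t) (hprof : ∀ m : ℕ, 1 / ta ^ 2 + bs * (m : ℝ) ≤ 1 / (t m) ^ 2)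
    (hg : 0 < g) (h2g : 2 * g ≤ γ)
    (hs1 : 4 * Cm * g ≤ bs * (1 - θ))
    (hs2 : g ^ 2 * (1 / gs ^ 2 + Cm * γ / (1 - θ) ^ 2 + (2 * Cm / ((1 - θ) * bs)) ^ 2) ≤ 3 / 4)
    (hs4 : 64 * Cm * g ^ 3 ≤ (1 - θ) ^ 2) :
    |(1 / (solution B g 1) ^ 2 - 1 / g ^ 2) - β₀| ≤ 2 * Cm * g / (1 - θ) := by
  obtain ⟨hss, hsf, -, -⟩ := memFlow_solution_of_reference hB hCm hθ0 hθ1 hbs hta hts htf hprof hg h2g hs1 hs2 hs4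
  have henv := le_two_mul_pin_of_reference_flow hB hCm hθ0 hθ1 hbs hta hts htf hprof hss hsf hs1 hs2
  have e0 := hsf.2 0
  rw [hsf.1, zero_add] at e0
  have heq : 1 / (solution B g 1) ^ 2 - 1 / g ^ 2 = B (fun j => solution B g (1 + j)) := by linarith
  rw [heq]
  have h := abs_sub_valueAtZero_le (a := 2 * g) hCm hθ0 hθ1 h0 (seqBox_shift hss 1) (fun j => henv (1 + j))
  calc |B (fun j => solution B g (1 + j)) - β₀| ≤ Cm * (2 * g) / (1 - θ) := h
    _ = 2 * Cm * g / (1 - θ) := by ring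

end

end Summit.QuantumFields.BalabanUV.Beta.EriceFlowEnclosureB12AsPrintedHistoryContagionShiftFlowZeroClock
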